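import Summits.AnomalousDissipation.AnomalousDissipation.Theorems.WazewskiBlockPlanarGalerkinNoTrapOrthogonality
import Summits.AnomalousDissipation.AnomalousDissipation.Theorems.WazewskiBlockPlanarGalerkinNoTrapCoeffODE
import Literature.Analysis.FluidPDE.NSGalerkinEnstrophy2D

/-!
# Route `WazewskiBlock`, support item `PlanarGalerkinNoTrap` (stmt-AnomalousDissipation-10356):
# energy and enstrophy calculus of a planar Galerkin trajectory on `𝕋³`, in Fourier coordinates

Helper file for the proof of
`Summit.AnomalousDissipation.AnomalousDissipation.Theses.WazewskiBlock.PlanarGalerkinNoTrap`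
(Alexakis–Doering 2006, §2, at Galerkin level). For a field-level Galerkin trajectory `U` of order
`N` on `𝕋³` driven by a steady trigonometric-polynomial force `f` of order `m`, whose slices are
planar (`U t x 2 = 0`) and vertically invariant, this file exports
(`exists_planar_budget_functions`) the five continuous scalar functions of time that the
no-trap argument consumes — energy `e = ∑‖α k‖² = 2·KE`, enstrophy `G = 4π²∑|k|²‖α k‖² = ‖∇U‖²`,
palinstrophy `Lp = 16π⁴∑|k|⁴‖α k‖² = ‖ΔU‖²`, the enstrophy forcing `P = (P_N f, ΔU)` and the work
`Wk = (f, U)`, `α` the coefficient curve of `U` (`isGalerkinTrajectory_coeff`) — together with: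

* the **energy identity** in differential form, `e' = 2(-νG + Wk)`
  (`Literature.Analysis.FluidPDE.hasDerivWithinAt_energy`);
* the **planar enstrophy identity** in differential form, `G' = 2(-νLp - P)` — the tree's
  every-dimension identity `hasDerivWithinAt_enstrophy` with the cubic term killed by
  `integral_inner_laplacian_convect_self_eq_zero_of_planar` (FMRT 2001 (A.62)/(A.65) for planar
  `x₂`-independent fields of `𝕋³`);
* the dictionary `KE (U t) = e t / 2`, `(f, U t) = Wk t`;
* the elementary bounds `|P| ≤ L₀ √e` (Cauchy–Schwarz, with the `N`-INDEPENDENT constant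
  `L₀² = ∑_{|k|² ≤ m²} (4π²|k|²)² ‖f̂ k‖²`, i.e. `‖Δf‖²`), the interpolation
  `G ≤ (λ/2) Lp + e/(2λ)` (termwise AM–GM, i.e. `‖∇U‖² ≤ ‖U‖‖ΔU‖`), and `G 0 ≤ 4π²N² e 0`.

References: A. Alexakis, C. R. Doering, Phys. Lett. A 359 (2006), §2; C. Foias, O. Manley,
R. Rosa, R. Temam, *Navier–Stokes Equations and Turbulence*, CUP 2001, App. II.A (A.62)–(A.65).
-/

-- `Summit.<Summit>.<Problem>` is the tree's mandated summit-side namespace (CONVENTIONS §2); for this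
-- single-conjunct summit the two coincide, so the duplicate is deliberate.
set_option linter.dupNamespace false

noncomputable section

open MeasureTheory Set Filter Topology UnitAddTorus
open scoped InnerProductSpace RealInnerProductSpace

namespace Summit.AnomalousDissipation.AnomalousDissipation.Theorems.WazewskiBlock.PlanarGalerkinNoTrap

open Literature.Analysis.FunctionSpaces Literature.Analysis.FunctionSpaces.Torus
open Literature.Analysis.FluidPDE

/-! ### The budget functions of a planar Galerkin trajectory -/

/-- **Energy/enstrophy budget of a planar Galerkin trajectory in Fourier coordinates.** Let `f` be
a Galerkin mode of order `m` on `𝕋³` (a real divergence-free vector trigonometric polynomial) and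
`U` a field-level Galerkin trajectory of order `N` with viscosity `ν` and force `f`
(`Torus.IsGalerkinTrajectory ν f N U`) whose slices `U t`, `t ≥ 0`, are planar and vertically
invariant. With `α` the coefficient curve of `U` and `f̂|_{≤N}` the force coefficients, the
functions `e = ∑ₖ‖α k‖²`, `G = 4π²∑ₖ|k|²‖α k‖²`, `Lp = 16π⁴∑ₖ|k|⁴‖α k‖²`,
`P = ∑ₖ Re⟪f̂ k, -4π²|k|² α k⟫`, `Wk = ∑ₖ Re⟪f̂ k, α k⟫` are continuous, `e, G ≥ 0`, and:
`e' = 2(-νG + Wk)` and `G' = 2(-νLp - P)` on every `[0, T]` (energy identity; planar enstrophy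
identity, FMRT (A.65), cubic term zero by (A.62)); `KE (U t) = e t/2` and `(f, U t) = Wk t` for
`t ≥ 0` (Parseval); `|P| ≤ L₀ √e` with `L₀ = (∑_{|k|²≤m²} (4π²|k|²)²‖f̂ k‖²)^{1/2}` independent
of `N` (Cauchy–Schwarz); `G ≤ (λ/2)Lp + e/(2λ)` for every `λ > 0` (AM–GM termwise); and
`G 0 ≤ 4π²N² e 0` (band limitation). This is the Galerkin-level input of Alexakis–Doering 2006,
§2. [folklore] -/
theorem exists_planar_budget_functions {ν : ℝ} {m N : ℕ}
    {f : UnitAddTorus (Fin 3) → EuclideanSpace ℝ (Fin 3)}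
    {U : ℝ → UnitAddTorus (Fin 3) → EuclideanSpace ℝ (Fin 3)}
    (hf : IsGalerkinMode m f) (hU : Torus.IsGalerkinTrajectory ν f N U)
    (hpl : ∀ t : ℝ, 0 ≤ t → (∀ x, U t x 2 = 0) ∧
      ∀ (s : UnitAddCircle) (x : UnitAddTorus (Fin 3)), U t (x + Pi.single (2 : Fin 3) s) = U t x) :
    ∃ e G Lp P Wk : ℝ → ℝ,
      Continuous e ∧ Continuous G ∧ Continuous Lp ∧ Continuous P ∧ Continuous Wk ∧
      (∀ τ, 0 ≤ e τ) ∧ (∀ τ, 0 ≤ G τ) ∧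
      (∀ T : ℝ, ∀ τ ∈ Icc 0 T, HasDerivWithinAt e (2 * (-(ν * G τ) + Wk τ)) (Icc 0 T) τ) ∧
      (∀ T : ℝ, ∀ τ ∈ Icc 0 T, HasDerivWithinAt G (2 * (-(ν * Lp τ) - P τ)) (Icc 0 T) τ) ∧
      (∀ τ : ℝ, 0 ≤ τ → kineticEnergy (U τ) = e τ / 2) ∧
      (∀ τ : ℝ, 0 ≤ τ → ∫ x, ⟪f x, U τ x⟫ = Wk τ) ∧
      (∀ τ : ℝ, |P τ| ≤ Real.sqrt (∑ k ∈ freqBall m, (4 * Real.pi ^ 2 * freqNormSq k) ^ 2 *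
        ‖mFourierCoeff (EuclideanSpace.complexify ∘ f) k‖ ^ 2) * Real.sqrt (e τ)) ∧
      (∀ (τ lam : ℝ), 0 < lam → G τ ≤ lam / 2 * Lp τ + e τ / (2 * lam)) ∧
      G 0 ≤ 4 * Real.pi ^ 2 * (N : ℝ) ^ 2 * e 0 := by
  have hS : ∀ k ∈ freqBall (d := Fin 3) N, -k ∈ freqBall (d := Fin 3) N := neg_mem_freqBall_of_mem
  have hf2 : MemLp f 2 volume := hf.isSmooth.memLp 2
  have htraj := isGalerkinTrajectory_coeff hU hf2
  set g : ↥(freqBall (d := Fin 3) N) → EuclideanSpace ℂ (Fin 3) := fourierRestrict (freqBall N) f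
    with hg
  set α : ℝ → ↥(freqBall (d := Fin 3) N) → EuclideanSpace ℂ (Fin 3) :=
    fun τ => fourierRestrict (freqBall N) (U (max τ 0)) with hα
  have hgr : IsRealCoeff g := isRealCoeff_mFourierCoeff (hf2.integrable one_le_two)
  have hmem : ∀ τ, α τ ∈ galerkinSubspace (freqBall N) := htraj.mem
  have hα_cont : Continuous α := continuous_coeff hU
  have hαk : ∀ k, Continuous fun τ => α τ k := fun k => (continuous_apply k).comp hα_cont
  -- two elementary inequalities: AM–GM `x ≤ (λ/2)x² + 1/(2λ)` and Cauchy–Schwarz with square roots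
  have hamgm : ∀ (x : ℝ) {lam : ℝ}, 0 < lam → x ≤ lam / 2 * x ^ 2 + 1 / (2 * lam) := by
    intro x lam hlam
    rw [show lam / 2 * x ^ 2 + 1 / (2 * lam) = ((lam * x - 1) ^ 2 + 2 * lam * x) / (2 * lam) by
      field_simp; ring]
    rw [le_div_iff₀ (by positivity)]
    nlinarith [sq_nonneg (lam * x - 1)]
  have hCS : ∀ (a b : ↥(freqBall (d := Fin 3) N) → ℝ),
      ∑ i, a i * b i ≤ Real.sqrt (∑ i, a i ^ 2) * Real.sqrt (∑ i, b i ^ 2) := by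
    intro a b
    rw [← Real.sqrt_mul (Finset.sum_nonneg fun i _ => sq_nonneg (a i))]
    exact (le_abs_self _).trans (Real.abs_le_sqrt (Finset.sum_mul_sq_le_sq_mul_sq _ a b))
  -- the five functions
  refine ⟨fun τ => ∑ k : ↥(freqBall (d := Fin 3) N), ‖α τ k‖ ^ 2,
    fun τ => 4 * Real.pi ^ 2 *
      ∑ k : ↥(freqBall (d := Fin 3) N), freqNormSq (k : Fin 3 → ℤ) * ‖α τ k‖ ^ 2,
    fun τ => 16 * Real.pi ^ 4 *
      ∑ k : ↥(freqBall (d := Fin 3) N), freqNormSq (k : Fin 3 → ℤ) ^ 2 * ‖α τ k‖ ^ 2,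
    fun τ => ∑ k : ↥(freqBall (d := Fin 3) N), (inner ℂ (g k)
      (-(((4 * Real.pi ^ 2 * freqNormSq (k : Fin 3 → ℤ) : ℝ) : ℂ) • α τ k))).re,
    fun τ => ∑ k : ↥(freqBall (d := Fin 3) N), (inner ℂ (g k) (α τ k)).re,
    ?_, ?_, ?_, ?_, ?_, ?_, ?_, ?_, ?_, ?_, ?_, ?_, ?_, ?_⟩
  -- continuity
  · exact continuous_finsetSum _ fun k _ => (hαk k).norm.pow 2
  · exact continuous_const.mul (continuous_finsetSum _ fun k _ =>
      continuous_const.mul ((hαk k).norm.pow 2))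
  · exact continuous_const.mul (continuous_finsetSum _ fun k _ =>
      continuous_const.mul ((hαk k).norm.pow 2))
  · refine continuous_finsetSum _ fun k _ => Complex.continuous_re.comp ?_
    exact continuous_const.inner
      (((hαk k).const_smul (((4 * Real.pi ^ 2 * freqNormSq (k : Fin 3 → ℤ) : ℝ) : ℂ))).neg)
  · exact continuous_finsetSum _ fun k _ =>
      Complex.continuous_re.comp (continuous_const.inner (hαk k))
  -- nonnegativity
  · exact fun τ => Finset.sum_nonneg fun k _ => sq_nonneg _
  · exact fun τ => mul_nonneg (by positivity)
      (Finset.sum_nonneg fun k _ => mul_nonneg (freqNormSq_nonneg _) (sq_nonneg _))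
  -- energy identity in differential form
  · intro T τ hτ
    have h := hasDerivWithinAt_energy ν hS (htraj.hasDerivWithinAt T τ hτ) (hmem τ) hgr
    refine h.congr_deriv ?_
    beta_reduce
    rw [toReal_eGradNormSq_coeffExt hS (hmem τ).1,
      integral_inner_realTrigPoly_realTrigPoly hS (hgr.isConjSymm_coeffExt hS)
        ((hmem τ).1.isConjSymm_coeffExt hS), ← Finset.sum_coe_sort (freqBall N)]
    simp only [coeffExt_coe]
  -- planar enstrophy identity in differential form
  · intro T τ hτ
    have h := hasDerivWithinAt_enstrophy ν hS (htraj.hasDerivWithinAt T τ hτ) (hmem τ) hgr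
    refine h.congr_deriv ?_
    beta_reduce
    have hu : realTrigPoly (freqBall N) (coeffExt (freqBall N) (α τ)) = U τ :=
      (eq_realTrigPoly_coeff hU hτ.1).symm
    have hcubic : ∫ x, ⟪Torus.laplacian (realTrigPoly (freqBall N) (coeffExt (freqBall N) (α τ))) x,
        convect (realTrigPoly (freqBall N) (coeffExt (freqBall N) (α τ)))
          (realTrigPoly (freqBall N) (coeffExt (freqBall N) (α τ))) x⟫ = 0 := by
      rw [hu]
      exact integral_inner_laplacian_convect_self_eq_zero_of_planar (hU.isSmooth hτ.1)
        (hU.isDivFree hτ.1) (hpl τ hτ.1).1 (hpl τ hτ.1).2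
    rw [hcubic, toReal_eLaplacianNormSq_coeffExt hS (hmem τ).1,
      integral_inner_realTrigPoly_laplacian_eq_sum hS hgr (hmem τ).1]
    ring
  -- kinetic energy
  · intro τ hτ
    beta_reduce
    rw [eq_realTrigPoly_coeff hU hτ, kineticEnergy_realTrigPoly_coeffExt hS (hmem τ).1]
    ring
  -- work
  · intro τ hτ
    beta_reduce
    rw [eq_realTrigPoly_coeff hU hτ, integral_inner_realTrigPoly_right hS
      ((hmem τ).1.isConjSymm_coeffExt hS) hf2,
      sum_coeffExt (fun k v => (inner ℂ (mFourierCoeff (EuclideanSpace.complexify ∘ f) k) v).re)]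
    rfl
  -- the forcing bound `|P| ≤ L₀ √e`
  · intro τ
    beta_reduce
    have hterm : ∀ k : ↥(freqBall (d := Fin 3) N), |(inner ℂ (g k)
        (-(((4 * Real.pi ^ 2 * freqNormSq (k : Fin 3 → ℤ) : ℝ) : ℂ) • α τ k))).re| ≤
        (4 * Real.pi ^ 2 * freqNormSq (k : Fin 3 → ℤ) * ‖g k‖) * ‖α τ k‖ := by
      intro k
      have hq : 0 ≤ 4 * Real.pi ^ 2 * freqNormSq (k : Fin 3 → ℤ) :=
        mul_nonneg (by positivity) (freqNormSq_nonneg _)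
      calc |(inner ℂ (g k) (-(((4 * Real.pi ^ 2 * freqNormSq (k : Fin 3 → ℤ) : ℝ) : ℂ) • α τ k))).re|
          ≤ ‖inner ℂ (g k) (-(((4 * Real.pi ^ 2 * freqNormSq (k : Fin 3 → ℤ) : ℝ) : ℂ) • α τ k))‖ :=
            Complex.abs_re_le_norm _
        _ ≤ ‖g k‖ * ‖-(((4 * Real.pi ^ 2 * freqNormSq (k : Fin 3 → ℤ) : ℝ) : ℂ) • α τ k)‖ :=
            norm_inner_le_norm _ _
        _ = (4 * Real.pi ^ 2 * freqNormSq (k : Fin 3 → ℤ) * ‖g k‖) * ‖α τ k‖ := by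
            rw [norm_neg, norm_smul, Complex.norm_real, Real.norm_of_nonneg hq]
            ring
    have hsum_le : |∑ k : ↥(freqBall (d := Fin 3) N), (inner ℂ (g k)
        (-(((4 * Real.pi ^ 2 * freqNormSq (k : Fin 3 → ℤ) : ℝ) : ℂ) • α τ k))).re| ≤
        ∑ k : ↥(freqBall (d := Fin 3) N),
          (4 * Real.pi ^ 2 * freqNormSq (k : Fin 3 → ℤ) * ‖g k‖) * ‖α τ k‖ :=
      (Finset.abs_sum_le_sum_abs _ _).trans (Finset.sum_le_sum fun k _ => hterm k)
    refine hsum_le.trans ((hCS _ _).trans ?_)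
    refine mul_le_mul_of_nonneg_right (Real.sqrt_le_sqrt ?_) (Real.sqrt_nonneg _)
    -- `∑_{|k|≤N} (4π²|k|²‖f̂ k‖)² ≤ ∑_{|k|≤m} (4π²|k|²)²‖f̂ k‖²` since `f̂ = 0` off `|k| ≤ m`
    have hzero : ∀ k : Fin 3 → ℤ, k ∉ freqBall m →
        (4 * Real.pi ^ 2 * freqNormSq k) ^ 2 * ‖mFourierCoeff (EuclideanSpace.complexify ∘ f) k‖ ^ 2
          = 0 := by
      intro k hk
      rw [hf.mFourierCoeff_eq_zero (not_mem_freqBall.1 hk), norm_zero]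
      ring
    calc ∑ k : ↥(freqBall (d := Fin 3) N), (4 * Real.pi ^ 2 * freqNormSq (k : Fin 3 → ℤ) * ‖g k‖) ^ 2
        = ∑ k ∈ freqBall (d := Fin 3) N, (4 * Real.pi ^ 2 * freqNormSq k) ^ 2 *
            ‖mFourierCoeff (EuclideanSpace.complexify ∘ f) k‖ ^ 2 := by
          rw [← Finset.sum_coe_sort (freqBall N)]
          exact Finset.sum_congr rfl fun k _ => by rw [hg, fourierRestrict_apply]; ring
      _ = ∑ k ∈ (freqBall (d := Fin 3) N).filter (· ∈ freqBall m),
            (4 * Real.pi ^ 2 * freqNormSq k) ^ 2 *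
              ‖mFourierCoeff (EuclideanSpace.complexify ∘ f) k‖ ^ 2 := by
          rw [Finset.sum_filter_of_ne]
          intro k _ hne
          by_contra hkm
          exact hne (hzero k hkm)
      _ ≤ ∑ k ∈ freqBall m, (4 * Real.pi ^ 2 * freqNormSq k) ^ 2 *
            ‖mFourierCoeff (EuclideanSpace.complexify ∘ f) k‖ ^ 2 := by
          refine Finset.sum_le_sum_of_subset_of_nonneg (fun k hk => (Finset.mem_filter.1 hk).2)
            fun k _ _ => mul_nonneg (sq_nonneg _) (sq_nonneg _)
  -- the interpolation `G ≤ (λ/2) Lp + e/(2λ)`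
  · intro τ lam hlam
    beta_reduce
    rw [Finset.mul_sum, Finset.mul_sum, Finset.mul_sum, Finset.sum_div, ← Finset.sum_add_distrib]
    refine Finset.sum_le_sum fun k _ => ?_
    have hx := hamgm (4 * Real.pi ^ 2 * freqNormSq (k : Fin 3 → ℤ)) hlam
    have hn : 0 ≤ ‖α τ k‖ ^ 2 := sq_nonneg _
    calc 4 * Real.pi ^ 2 * (freqNormSq (k : Fin 3 → ℤ) * ‖α τ k‖ ^ 2)
        = (4 * Real.pi ^ 2 * freqNormSq (k : Fin 3 → ℤ)) * ‖α τ k‖ ^ 2 := by ring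
      _ ≤ (lam / 2 * (4 * Real.pi ^ 2 * freqNormSq (k : Fin 3 → ℤ)) ^ 2 + 1 / (2 * lam)) *
            ‖α τ k‖ ^ 2 := mul_le_mul_of_nonneg_right hx hn
      _ = lam / 2 * (16 * Real.pi ^ 4 * (freqNormSq (k : Fin 3 → ℤ) ^ 2 * ‖α τ k‖ ^ 2)) +
            ‖α τ k‖ ^ 2 / (2 * lam) := by ring
  -- the initial enstrophy `G 0 ≤ 4π²N² e 0`
  · beta_reduce
    have hle : ∑ k : ↥(freqBall (d := Fin 3) N), freqNormSq (k : Fin 3 → ℤ) * ‖α 0 k‖ ^ 2 ≤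
        ∑ k : ↥(freqBall (d := Fin 3) N), (N : ℝ) ^ 2 * ‖α 0 k‖ ^ 2 :=
      Finset.sum_le_sum fun k _ => mul_le_mul_of_nonneg_right (mem_freqBall.1 k.2) (sq_nonneg _)
    rw [← Finset.mul_sum] at hle
    calc 4 * Real.pi ^ 2 * ∑ k : ↥(freqBall (d := Fin 3) N), freqNormSq (k : Fin 3 → ℤ) * ‖α 0 k‖ ^ 2
        ≤ 4 * Real.pi ^ 2 * ((N : ℝ) ^ 2 * ∑ k : ↥(freqBall (d := Fin 3) N), ‖α 0 k‖ ^ 2) :=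
          mul_le_mul_of_nonneg_left hle (by positivity)
      _ = 4 * Real.pi ^ 2 * (N : ℝ) ^ 2 * ∑ k : ↥(freqBall (d := Fin 3) N), ‖α 0 k‖ ^ 2 := by
          ring

end Summit.AnomalousDissipation.AnomalousDissipation.Theorems.WazewskiBlock.PlanarGalerkinNoTrap

end
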